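import Literature.Geometry.Riemannian.MetricFlowWassersteinMonotone
import HarnessLib

/-!
# Almost monotonicity of the average distance along a conjugate heat flow (Bamler 2023, §4.2,
# Lemma, (4.4), lower bound)

R. Bamler, *Compactness theory of the space of super Ricci flows*, Invent. Math. 233 (2023), §4.2,
Lemma (*"We also obtain almost monotonicity of `t ↦ ∫_{𝒳_t}∫_{𝒳_t} d_t dμ_t dμ_t`"*), the lower
bound in (4.4): for an `H`-concentrated metric flow `𝒳`, a conjugate heat flow `(μ_t)_{t ∈ I'}`
and `s ≤ t` in `I'`,
`−√(H(t − s)) ≤ ∫∫ f dμ_t dμ_t − √(H(t − s)) ≤ ∫∫ d_t dμ_t dμ_t − ∫∫ d_s dμ_s dμ_s`, i.e.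
**`∫∫ d_s dμ_s dμ_s ≤ ∫∫ d_t dμ_t dμ_t + √(H(t − s))`** (as `f ≥ 0`). Printed proof: write
`μ_s = ∫ ν_{y;s} dμ_t(y)` (conjugate heat flow), so that
`∫∫ d_s dμ_s dμ_s = ∫∫ (∫∫ d_s dν_{y₁;s} dν_{y₂;s}) dμ_t(y₁) dμ_t(y₂)`, and use the first display
of the proof, `∫∫ d_s dν_{y₁;s} dν_{y₂;s} ≤ d^{𝒳_s}_{W₁}(ν_{y₁;s}, ν_{y₂;s}) + √(H(t − s))`
together with (c) of the Proposition of §3.2, `d_{W₁}(ν_{y₁;s}, ν_{y₂;s}) ≤ d_t(y₁, y₂)`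
(both in `MetricFlowWassersteinMonotone.lean`, the latter for a compact slice `𝒳_s`).

* `MetricFlow.IsConjugateHeatFlow.eq_bind` — `μ_s = ∫ ν_{y;s} dμ_t(y)` as `Measure.bind`;
* `MetricFlow.IsHConcentrated.lintegral_lintegral_edist_conjugateHeatFlow_le` — **the almost
  monotonicity `∫∫ d_s dμ_s dμ_s ≤ ∫∫ d_t dμ_t dμ_t + √(H(t − s))`**;
* `MetricFlow.IsHConcentrated.lintegral_lintegral_f_add_le` — the sharper middle inequality of
  (4.4), `∫∫ f dμ_t dμ_t − √(H(t − s)) ≤ ∫∫ d_t dμ_t dμ_t − ∫∫ d_s dμ_s dμ_s` with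
  `f(y₁, y₂) = d_t(y₁, y₂) − d_{W₁}(ν_{y₁;s}, ν_{y₂;s}) ≥ 0`, in the `[0, ∞]`-valued form
  `∫∫ f dμ_t dμ_t + ∫∫ d_s dμ_s dμ_s ≤ ∫∫ d_t dμ_t dμ_t + √(H(t − s))`.

Everything is proved; no definitions, no named facts.

## References

* R. H. Bamler, *Compactness theory of the space of super Ricci flows*, Invent. Math. 233 (2023),
  §4.2, Lemma (almost monotonicity of the average distance), (4.4). [Bamler2023]
-/

noncomputable section

open Set MeasureTheory ProbabilityTheory Filter Topology
open scoped ENNReal NNReal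

namespace Literature.Geometry.Riemannian

universe u

namespace MetricFlow

variable {I : Set ℝ} {𝒳 : MetricFlow.{u} I}

/-- **A conjugate heat flow is reproduced by the conjugate heat kernels**:
`μ_s = ∫_{𝒳_t} ν_{y;s} dμ_t(y)` for `s ≤ t` in `I'`, as `Measure.bind` with the Markov kernel
`MetricFlow.kernel`. [cite: Bamler2023, §3.2, Definition (conjugate heat flow)] -/
theorem IsConjugateHeatFlow.eq_bind {I' : Set ℝ} {μ : ∀ t : I, Measure (𝒳.Slice t)}
    (hμ : 𝒳.IsConjugateHeatFlow I' μ) {s t : I} (hs : (s : ℝ) ∈ I') (ht : (t : ℝ) ∈ I')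
    (hst : (s : ℝ) ≤ t) : μ s = (μ t).bind (𝒳.kernel hst) := by
  ext S hS
  rw [Measure.bind_apply hS (𝒳.kernel hst).measurable.aemeasurable]
  exact hμ.2 hs ht hst S hS

/-- **Almost monotonicity of the average distance** (Bamler 2023, §4.2, Lemma, lower bound in
(4.4)): in an `H`-concentrated metric flow, for a conjugate heat flow `(μ_t)_{t ∈ I'}` and
`s ≤ t` in `I'` with compact slice `𝒳_s`,
`∫∫ d_s dμ_s dμ_s ≤ ∫∫ d_t dμ_t dμ_t + √(H(t − s))` — via `μ_s = ∫ ν_{y;s} dμ_t(y)`,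
`∫∫ d_s dν_{y₁;s} dν_{y₂;s} ≤ d_{W₁}(ν_{y₁;s}, ν_{y₂;s}) + √(H(t − s)) ≤ d_t(y₁, y₂) + √(H(t − s))`.
[cite: Bamler2023, §4.2, Lemma (almost monotonicity of the average distance), (4.4)] -/
theorem IsHConcentrated.lintegral_lintegral_edist_conjugateHeatFlow_le {H : ℝ}
    (hH : 𝒳.IsHConcentrated H) {I' : Set ℝ} {μ : ∀ t : I, Measure (𝒳.Slice t)}
    (hμ : 𝒳.IsConjugateHeatFlow I' μ) {s t : I} [CompactSpace (𝒳.Slice s)] (hs : (s : ℝ) ∈ I')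
    (ht : (t : ℝ) ∈ I') (hst : (s : ℝ) ≤ t) :
    ∫⁻ x₁, ∫⁻ x₂, edist x₁ x₂ ∂(μ s) ∂(μ s) ≤
      ∫⁻ y₁, ∫⁻ y₂, edist y₁ y₂ ∂(μ t) ∂(μ t) + (ENNReal.ofReal (H * ((t : ℝ) - s))) ^ (1 / 2 : ℝ) := by
  haveI := hμ.1 t ht
  haveI : SecondCountableTopology (𝒳.Slice s) := UniformSpace.secondCountable_of_separable _
  haveI : SecondCountableTopology (𝒳.Slice t) := UniformSpace.secondCountable_of_separable _
  set κ := 𝒳.kernel hst with hκ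
  set c : ℝ≥0∞ := (ENNReal.ofReal (H * ((t : ℝ) - s))) ^ (1 / 2 : ℝ) with hc
  have hb : μ s = (μ t).bind κ := hμ.eq_bind hs ht hst
  -- the inner double integral `g(x₁, y₂) := ∫ d_s(x₁, ·) dν_{y₂;s}` is jointly measurable
  set g : 𝒳.Slice s × 𝒳.Slice t → ℝ≥0∞ := fun a ↦ ∫⁻ x₂, edist a.1 x₂ ∂(κ a.2) with hg_def
  have hg : Measurable g := by
    have h := Measurable.lintegral_kernel_prod_right (κ := Kernel.prodMkLeft (𝒳.Slice s) κ)
      (f := fun (a : 𝒳.Slice s × 𝒳.Slice t) (b : 𝒳.Slice s) ↦ edist a.1 b)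
      (continuous_fst.fst.edist continuous_snd).measurable
    simpa only [Kernel.prodMkLeft_apply] using h
  -- Step 1: `∫∫ d_s dμ_s dμ_s ≤ ∫_{μ_t} ∫_{ν_{y₁;s}} ∫_{μ_t} g(x₁, y₂)`
  have h1 : ∀ x₁ : 𝒳.Slice s, ∫⁻ x₂, edist x₁ x₂ ∂(μ s) ≤ ∫⁻ y₂, g (x₁, y₂) ∂(μ t) := fun x₁ ↦ by
    rw [hb]
    exact Measure.lintegral_bind_le _ _ _
  have h2 : ∫⁻ x₁, ∫⁻ y₂, g (x₁, y₂) ∂(μ t) ∂(μ s) ≤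
      ∫⁻ y₁, ∫⁻ x₁, ∫⁻ y₂, g (x₁, y₂) ∂(μ t) ∂(κ y₁) ∂(μ t) := by
    rw [hb]
    exact Measure.lintegral_bind_le _ _ _
  -- Step 2: swap the two inner integrals and bound slice-wise
  have h3 : ∀ y₁ : 𝒳.Slice t, ∫⁻ x₁, ∫⁻ y₂, g (x₁, y₂) ∂(μ t) ∂(κ y₁) ≤
      ∫⁻ y₂, (edist y₁ y₂ + c) ∂(μ t) := fun y₁ ↦ by
    have hg' : Measurable (Function.uncurry fun (x₁ : 𝒳.Slice s) (y₂ : 𝒳.Slice t) ↦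
        g (x₁, y₂)) := hg.comp (measurable_fst.prodMk measurable_snd)
    rw [lintegral_lintegral_swap hg'.aemeasurable]
    refine lintegral_mono fun y₂ ↦ ?_
    exact hH.lintegral_lintegral_edist_condKernel_le_edist hst y₁ y₂
  -- Step 3: assemble
  calc ∫⁻ x₁, ∫⁻ x₂, edist x₁ x₂ ∂(μ s) ∂(μ s)
      ≤ ∫⁻ x₁, ∫⁻ y₂, g (x₁, y₂) ∂(μ t) ∂(μ s) := lintegral_mono h1
    _ ≤ ∫⁻ y₁, ∫⁻ x₁, ∫⁻ y₂, g (x₁, y₂) ∂(μ t) ∂(κ y₁) ∂(μ t) := h2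
    _ ≤ ∫⁻ y₁, ∫⁻ y₂, (edist y₁ y₂ + c) ∂(μ t) ∂(μ t) := lintegral_mono h3
    _ = ∫⁻ y₁, (∫⁻ y₂, edist y₁ y₂ ∂(μ t) + c) ∂(μ t) := by
        refine lintegral_congr fun y₁ ↦ ?_
        rw [lintegral_add_right _ measurable_const, lintegral_const, measure_univ, mul_one]
    _ = ∫⁻ y₁, ∫⁻ y₂, edist y₁ y₂ ∂(μ t) ∂(μ t) + c := by
        rw [lintegral_add_right _ measurable_const, lintegral_const, measure_univ, mul_one]

/-- **The middle inequality of Bamler 2023, (4.4)**: with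
`f(y₁, y₂) := d_t(y₁, y₂) − d^{𝒳_s}_{W₁}(ν_{y₁;s}, ν_{y₂;s}) ≥ 0` ((4.3); truncated subtraction in
`[0, ∞]`, harmless as `d_{W₁}(ν_{y₁;s}, ν_{y₂;s}) ≤ d_t(y₁, y₂)`),
`∫∫ f dμ_t dμ_t − √(H(t − s)) ≤ ∫∫ d_t dμ_t dμ_t − ∫∫ d_s dμ_s dμ_s`, stated additively:
`∫∫ f dμ_t dμ_t + ∫∫ d_s dμ_s dμ_s ≤ ∫∫ d_t dμ_t dμ_t + √(H(t − s))`. Printed proof: integrate (4.3),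
`f ≤ d_t − ∫∫ d_s dν_{y₁;s} dν_{y₂;s} + √(H(t − s))`, over `μ_t ⊗ μ_t` and use
`∫∫ (∫∫ d_s dν_{y₁;s} dν_{y₂;s}) dμ_t dμ_t = ∫∫ d_s dμ_s dμ_s` (`μ_s = ∫ ν_{y;s} dμ_t(y)`).
(No measurability of `(y₁, y₂) ↦ d_{W₁}(ν_{y₁;s}, ν_{y₂;s})` is needed: Lebesgue integrals of
arbitrary `[0, ∞]`-valued functions are additive against a measurable summand.)
[cite: Bamler2023, §4.2, Lemma (almost monotonicity of the average distance), (4.4)] -/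
theorem IsHConcentrated.lintegral_lintegral_f_add_le {H : ℝ}
    (hH : 𝒳.IsHConcentrated H) {I' : Set ℝ} {μ : ∀ t : I, Measure (𝒳.Slice t)}
    (hμ : 𝒳.IsConjugateHeatFlow I' μ) {s t : I} [CompactSpace (𝒳.Slice s)] (hs : (s : ℝ) ∈ I')
    (ht : (t : ℝ) ∈ I') (hst : (s : ℝ) ≤ t) :
    ∫⁻ y₁, ∫⁻ y₂, (edist y₁ y₂ - wassersteinW1 (𝒳.condKernel y₁ s) (𝒳.condKernel y₂ s))
        ∂(μ t) ∂(μ t) + ∫⁻ x₁, ∫⁻ x₂, edist x₁ x₂ ∂(μ s) ∂(μ s) ≤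
      ∫⁻ y₁, ∫⁻ y₂, edist y₁ y₂ ∂(μ t) ∂(μ t) + (ENNReal.ofReal (H * ((t : ℝ) - s))) ^ (1 / 2 : ℝ) := by
  haveI := hμ.1 t ht
  haveI : SecondCountableTopology (𝒳.Slice s) := UniformSpace.secondCountable_of_separable _
  haveI : SecondCountableTopology (𝒳.Slice t) := UniformSpace.secondCountable_of_separable _
  set κ := 𝒳.kernel hst with hκ
  set c : ℝ≥0∞ := (ENNReal.ofReal (H * ((t : ℝ) - s))) ^ (1 / 2 : ℝ) with hc
  have hb : μ s = (μ t).bind κ := hμ.eq_bind hs ht hst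
  -- `g(x₁, y₂) := ∫ d_s(x₁, ·) dν_{y₂;s}` and `D(y₁, y₂) := ∫ g(·, y₂) dν_{y₁;s}` are measurable
  set g : 𝒳.Slice s × 𝒳.Slice t → ℝ≥0∞ := fun a ↦ ∫⁻ x₂, edist a.1 x₂ ∂(κ a.2) with hg_def
  have hg : Measurable g := by
    have h := Measurable.lintegral_kernel_prod_right (κ := Kernel.prodMkLeft (𝒳.Slice s) κ)
      (f := fun (a : 𝒳.Slice s × 𝒳.Slice t) (b : 𝒳.Slice s) ↦ edist a.1 b)
      (continuous_fst.fst.edist continuous_snd).measurable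
    simpa only [Kernel.prodMkLeft_apply] using h
  set D : 𝒳.Slice t × 𝒳.Slice t → ℝ≥0∞ := fun b ↦ ∫⁻ x₁, g (x₁, b.2) ∂(κ b.1) with hD_def
  have hD : Measurable D := by
    have h := Measurable.lintegral_kernel_prod_right (κ := Kernel.prodMkRight (𝒳.Slice t) κ)
      (f := fun (b : 𝒳.Slice t × 𝒳.Slice t) (x₁ : 𝒳.Slice s) ↦ g (x₁, b.2))
      (hg.comp (measurable_snd.prodMk measurable_fst.snd))
    simpa only [Kernel.prodMkRight_apply] using h
  have hDy : ∀ y₁ : 𝒳.Slice t, Measurable fun y₂ ↦ D (y₁, y₂) := fun y₁ ↦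
    hD.comp (measurable_const.prodMk measurable_id)
  have hDint : Measurable fun y₁ : 𝒳.Slice t ↦ ∫⁻ y₂, D (y₁, y₂) ∂(μ t) :=
    hD.lintegral_prod_right'
  -- `∫∫ d_s dμ_s dμ_s ≤ ∫∫ D dμ_t dμ_t`
  have h1 : ∀ x₁ : 𝒳.Slice s, ∫⁻ x₂, edist x₁ x₂ ∂(μ s) ≤ ∫⁻ y₂, g (x₁, y₂) ∂(μ t) := fun x₁ ↦ by
    rw [hb]
    exact Measure.lintegral_bind_le _ _ _
  have h2 : ∫⁻ x₁, ∫⁻ y₂, g (x₁, y₂) ∂(μ t) ∂(μ s) ≤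
      ∫⁻ y₁, ∫⁻ x₁, ∫⁻ y₂, g (x₁, y₂) ∂(μ t) ∂(κ y₁) ∂(μ t) := by
    rw [hb]
    exact Measure.lintegral_bind_le _ _ _
  have h3 : ∀ y₁ : 𝒳.Slice t, ∫⁻ x₁, ∫⁻ y₂, g (x₁, y₂) ∂(μ t) ∂(κ y₁) =
      ∫⁻ y₂, D (y₁, y₂) ∂(μ t) := fun y₁ ↦ by
    have hg' : Measurable (Function.uncurry fun (x₁ : 𝒳.Slice s) (y₂ : 𝒳.Slice t) ↦
        g (x₁, y₂)) := hg.comp (measurable_fst.prodMk measurable_snd)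
    rw [lintegral_lintegral_swap hg'.aemeasurable]
  have hs_le : ∫⁻ x₁, ∫⁻ x₂, edist x₁ x₂ ∂(μ s) ∂(μ s) ≤ ∫⁻ y₁, ∫⁻ y₂, D (y₁, y₂) ∂(μ t) ∂(μ t) :=
    calc ∫⁻ x₁, ∫⁻ x₂, edist x₁ x₂ ∂(μ s) ∂(μ s)
        ≤ ∫⁻ x₁, ∫⁻ y₂, g (x₁, y₂) ∂(μ t) ∂(μ s) := lintegral_mono h1
      _ ≤ ∫⁻ y₁, ∫⁻ x₁, ∫⁻ y₂, g (x₁, y₂) ∂(μ t) ∂(κ y₁) ∂(μ t) := h2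
      _ = ∫⁻ y₁, ∫⁻ y₂, D (y₁, y₂) ∂(μ t) ∂(μ t) := lintegral_congr h3
  -- the pointwise estimate (4.3): `(d_t − d_{W₁}) + D ≤ d_t + √(H(t − s))`
  have hpt : ∀ y₁ y₂ : 𝒳.Slice t,
      (edist y₁ y₂ - wassersteinW1 (𝒳.condKernel y₁ s) (𝒳.condKernel y₂ s)) + D (y₁, y₂) ≤
        edist y₁ y₂ + c := fun y₁ y₂ ↦ by
    have hW : wassersteinW1 (𝒳.condKernel y₁ s) (𝒳.condKernel y₂ s) ≤ edist y₁ y₂ :=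
      𝒳.wassersteinW1_condKernel_le_edist hst y₁ y₂
    have hDle : D (y₁, y₂) ≤ wassersteinW1 (𝒳.condKernel y₁ s) (𝒳.condKernel y₂ s) + c :=
      hH.lintegral_lintegral_edist_condKernel_le hst y₁ y₂
    calc (edist y₁ y₂ - wassersteinW1 (𝒳.condKernel y₁ s) (𝒳.condKernel y₂ s)) + D (y₁, y₂)
        ≤ (edist y₁ y₂ - wassersteinW1 (𝒳.condKernel y₁ s) (𝒳.condKernel y₂ s)) +
            (wassersteinW1 (𝒳.condKernel y₁ s) (𝒳.condKernel y₂ s) + c) := add_le_add le_rfl hDle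
      _ = edist y₁ y₂ + c := by rw [← add_assoc, tsub_add_cancel_of_le hW]
  -- assemble
  calc ∫⁻ y₁, ∫⁻ y₂, (edist y₁ y₂ - wassersteinW1 (𝒳.condKernel y₁ s) (𝒳.condKernel y₂ s))
          ∂(μ t) ∂(μ t) + ∫⁻ x₁, ∫⁻ x₂, edist x₁ x₂ ∂(μ s) ∂(μ s)
      ≤ ∫⁻ y₁, ∫⁻ y₂, (edist y₁ y₂ - wassersteinW1 (𝒳.condKernel y₁ s) (𝒳.condKernel y₂ s))
          ∂(μ t) ∂(μ t) + ∫⁻ y₁, ∫⁻ y₂, D (y₁, y₂) ∂(μ t) ∂(μ t) := add_le_add le_rfl hs_le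
    _ = ∫⁻ y₁, (∫⁻ y₂, (edist y₁ y₂ - wassersteinW1 (𝒳.condKernel y₁ s) (𝒳.condKernel y₂ s))
          ∂(μ t) + ∫⁻ y₂, D (y₁, y₂) ∂(μ t)) ∂(μ t) := (lintegral_add_right _ hDint).symm
    _ = ∫⁻ y₁, ∫⁻ y₂, ((edist y₁ y₂ - wassersteinW1 (𝒳.condKernel y₁ s) (𝒳.condKernel y₂ s))
          + D (y₁, y₂)) ∂(μ t) ∂(μ t) :=
        lintegral_congr fun y₁ ↦ (lintegral_add_right _ (hDy y₁)).symm
    _ ≤ ∫⁻ y₁, ∫⁻ y₂, (edist y₁ y₂ + c) ∂(μ t) ∂(μ t) :=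
        lintegral_mono fun y₁ ↦ lintegral_mono fun y₂ ↦ hpt y₁ y₂
    _ = ∫⁻ y₁, (∫⁻ y₂, edist y₁ y₂ ∂(μ t) + c) ∂(μ t) := by
        refine lintegral_congr fun y₁ ↦ ?_
        rw [lintegral_add_right _ measurable_const, lintegral_const, measure_univ, mul_one]
    _ = ∫⁻ y₁, ∫⁻ y₂, edist y₁ y₂ ∂(μ t) ∂(μ t) + c := by
        rw [lintegral_add_right _ measurable_const, lintegral_const, measure_univ, mul_one]

end MetricFlow

end Literature.Geometry.Riemannian

end
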